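import Mathlib
import Summits.Ventures.HodgeRepro.Tier4.Target
import Summits.Ventures.HodgeRepro.Tier4.Line3.KMDatum
import Summits.Ventures.HodgeRepro.Tier4.Line3.KMDatumS
import Summits.Ventures.HodgeRepro.Tier4.Line3.Defs
import Summits.Ventures.HodgeRepro.Tier4.Line3.HeckeEquivarianceLemmas
import Summits.Ventures.HodgeRepro.Tier4.Line3.WittRank3
import Summits.Ventures.HodgeRepro.Tier4.Line3.TorusInvariance

/-!
# Tier4/Line3/MainClassReps — every class of the main orbit has a unitary representative `g_c • xm` (L3.6a, R2′)

Blind re-derivation cell `pub-hodge-repro`, Tier 4 «PROVE THE STEP» (README §9–§10), LINE L3, seat t4-L3-p1 (prover);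
support (S4d-0) of L3.6a `term_main_unfold` (lead S12253): the «support lemma of L3.6a» named in the skeleton's docstring
of `gRep` — the orbit relation `orbitStepL` is an equivalence relation (`U(H)(E′)` is a group, the torus is absorbed by
the lines), so a line tuple in the orbit of `lines xm` is `lines (g • xm)` for a single `g ∈ U(H)(E′)`
(`exists_unitary_of_orbitOf_eq`); hence the `if` in the skeleton's `gRep` takes its positive branch
(`exists_gRep`), and the chosen representative `mainRep K xm c = gRep K xm c • xm` is unitary-moved from `xm` and lies in
the class `c` (`gRep_isUnitaryOf`, `classOf_lines_mainRep`).

Nothing here asserts anything about the truth of (P); HC_CM is NOT proved by anyone in this repository.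
-/

set_option autoImplicit false

noncomputable section

namespace Summit.Ventures.HodgeRepro.Tier4.Line3

open Summit.Ventures.HodgeRepro.Tier4
open Matrix
open HeckeEquivariance

/-- The inverse of a unitary matrix is unitary (`cstar` of the inverse is the inverse of `cstar`). -/
theorem isUnitaryOf_inv {E : Type*} [Field E] (c : E ≃+* E) {H g : Matrix (Fin 3) (Fin 3) E}
    (hH : IsUnit H) (hg : IsUnitaryOf c H g) : IsUnitaryOf c H g⁻¹ := by
  have hgu : IsUnit g := by
    have h1 : IsUnit (cstar c g * H * g) := by rw [hg]; exact hH
    exact (IsUnit.mul_iff.mp h1).2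
  have hgd : IsUnit g.det := (Matrix.isUnit_iff_isUnit_det g).mp hgu
  have hcs : IsUnit (cstar c g) := isUnit_cstar c hgu
  have hcsd : IsUnit (cstar c g).det := (Matrix.isUnit_iff_isUnit_det _).mp hcs
  unfold IsUnitaryOf at hg ⊢
  -- `cstar c g⁻¹ = (cstar c g)⁻¹` and `H = (cstar c g)⁻¹ * H * g⁻¹` from `cstar c g * H * g = H`
  have h1 : cstar c g⁻¹ * cstar c g = 1 := by
    rw [← cstar_mul, Matrix.mul_nonsing_inv g hgd, cstar_one]
  have h2 : cstar c g⁻¹ = (cstar c g)⁻¹ := by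
    have := Matrix.mul_nonsing_inv (cstar c g) hcsd
    calc cstar c g⁻¹ = cstar c g⁻¹ * (cstar c g * (cstar c g)⁻¹) := by rw [this, Matrix.mul_one]
      _ = (cstar c g)⁻¹ := by rw [← Matrix.mul_assoc, h1, Matrix.one_mul]
  rw [h2]
  calc (cstar c g)⁻¹ * H * g⁻¹ = (cstar c g)⁻¹ * (cstar c g * H * g) * g⁻¹ := by rw [hg]
    _ = H := by
      rw [Matrix.mul_assoc (cstar c g) H g, ← Matrix.mul_assoc ((cstar c g)⁻¹), Matrix.nonsing_inv_mul _ hcsd,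
        Matrix.one_mul, Matrix.mul_assoc, Matrix.mul_nonsing_inv g hgd, Matrix.mul_one]

namespace T4Data

variable (X : T4Data)

/-- `lines` is invariant under the torus. -/
theorem lines_smul (t : Fin 4 → X.E) (ht : ∀ j, X.c (t j) * t j = 1) (x : X.Tuple) :
    X.lines (fun j => t j • x j) = X.lines x := by
  funext j
  exact (Quot.sound ⟨t j, ht j, rfl⟩).symm

/-- The chosen representatives of the lines of `x` differ from `x` by the torus. -/
theorem exists_torus_rep_lines (x : X.Tuple) :
    ∃ t : Fin 4 → X.E, (∀ j, X.c (t j) * t j = 1) ∧ X.rep (X.lines x) = fun j => t j • x j := by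
  have h : ∀ j, X.lineStep (x j) (Quot.out (Quot.mk X.lineStep (x j))) := fun j => lineStep_out_mk X (x j)
  choose t ht using h
  exact ⟨t, fun j => (ht j).1, funext fun j => (ht j).2⟩

/-- A single orbit step from `lines x` lands on `lines (g • x)`. -/
theorem orbitStepL_lines_iff (x : X.Tuple) (w' : X.LineTuple) :
    X.orbitStepL (X.lines x) w' ↔ ∃ g : Matrix (Fin 3) (Fin 3) X.E, IsUnitaryOf X.c X.H g ∧
      w' = X.lines (fun j => g *ᵥ x j) := by
  constructor
  · rintro ⟨g, hg, hw⟩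
    obtain ⟨t, ht, hrep⟩ := X.exists_torus_rep_lines x
    refine ⟨g, hg, funext fun j => ?_⟩
    rw [hw j]
    have : Quot.out (X.lines x j) = t j • x j := congrFun hrep j
    show Quot.mk X.lineStep (g *ᵥ Quot.out (X.lines x j)) = Quot.mk X.lineStep (g *ᵥ x j)
    rw [this, Matrix.mulVec_smul]
    exact Quot.sound ⟨t j, ht j, rfl⟩ |>.symm
  · rintro ⟨g, hg, rfl⟩
    obtain ⟨t, ht, hrep⟩ := X.exists_torus_rep_lines x
    refine ⟨g, hg, fun j => ?_⟩
    have : Quot.out (X.lines x j) = t j • x j := congrFun hrep j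
    show Quot.mk X.lineStep (g *ᵥ x j) = Quot.mk X.lineStep (g *ᵥ Quot.out (X.lines x j))
    rw [this, Matrix.mulVec_smul]
    exact Quot.sound ⟨t j, ht j, rfl⟩

/-- One orbit step backwards: if `orbitStepL a b` and `b = lines x₂` then `a = lines (g⁻¹ • x₂)`. -/
theorem exists_unitary_of_orbitStepL_symm {a b : X.LineTuple} (hab : X.orbitStepL a b) (x₂ : X.Tuple)
    (hb : b = X.lines x₂) :
    ∃ g : Matrix (Fin 3) (Fin 3) X.E, IsUnitaryOf X.c X.H g ∧ a = X.lines (fun j => g *ᵥ x₂ j) := by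
  have hH : IsUnit X.H := isUnit_H X
  obtain ⟨g, hg, hab'⟩ := hab
  -- `b = lines (g • rep a)`
  have hb' : b = X.lines (fun j => g *ᵥ X.rep a j) := funext fun j => hab' j
  have hgd : IsUnit g.det := (isUnit_det_of_isUnitaryOf X hg)
  obtain ⟨t, ht, hx₂⟩ := X.exists_torus_of_lines_eq (hb'.symm.trans hb)
  refine ⟨g⁻¹, isUnitaryOf_inv X.c hH hg, ?_⟩
  have hx₂' : x₂ = fun j => t j • (g *ᵥ X.rep a j) := funext hx₂
  rw [hx₂']
  have : (fun j => g⁻¹ *ᵥ (t j • (g *ᵥ X.rep a j))) = fun j => t j • X.rep a j := by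
    funext j
    rw [Matrix.mulVec_smul, Matrix.mulVec_mulVec, Matrix.nonsing_inv_mul g hgd, Matrix.one_mulVec]
  rw [this, X.lines_smul t ht, X.lines_rep]

/-- **A LINE TUPLE IN THE ORBIT OF `lines x` IS `lines (g • x)` FOR A SINGLE UNITARY `g`** (the orbit relation is an
equivalence relation: `U(H)(E′)` is a group and the torus is absorbed by the lines). -/
theorem exists_unitary_of_orbitOf_eq (x : X.Tuple) {w : X.LineTuple} (h : X.orbitOf (X.lines x) = X.orbitOf w) :
    ∃ g : Matrix (Fin 3) (Fin 3) X.E, IsUnitaryOf X.c X.H g ∧ w = X.lines (fun j => g *ᵥ x j) := by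
  have hgen := Quot.eqvGen_exact h
  -- both directions at once, by induction on the chain
  have key : ∀ w₁ w₂ : X.LineTuple, Relation.EqvGen X.orbitStepL w₁ w₂ →
      (∀ x₁ : X.Tuple, w₁ = X.lines x₁ →
        ∃ g : Matrix (Fin 3) (Fin 3) X.E, IsUnitaryOf X.c X.H g ∧ w₂ = X.lines (fun j => g *ᵥ x₁ j)) ∧
      (∀ x₂ : X.Tuple, w₂ = X.lines x₂ →
        ∃ g : Matrix (Fin 3) (Fin 3) X.E, IsUnitaryOf X.c X.H g ∧ w₁ = X.lines (fun j => g *ᵥ x₂ j)) := by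
    intro w₁ w₂ hgen
    induction hgen with
    | rel a b hab =>
      refine ⟨fun x₁ hx₁ => ?_, fun x₂ hx₂ => X.exists_unitary_of_orbitStepL_symm hab x₂ hx₂⟩
      subst hx₁
      exact (X.orbitStepL_lines_iff x₁ b).mp hab
    | refl a =>
      have h1 : IsUnitaryOf X.c X.H 1 := by
        unfold IsUnitaryOf; rw [cstar_one, Matrix.one_mul, Matrix.mul_one]
      refine ⟨fun x₁ hx₁ => ⟨1, h1, ?_⟩, fun x₂ hx₂ => ⟨1, h1, ?_⟩⟩
      · rw [hx₁]; simp [Matrix.one_mulVec]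
      · rw [hx₂]; simp [Matrix.one_mulVec]
    | symm a b _ ih => exact ⟨ih.2, ih.1⟩
    | trans a b d _ _ ih₁ ih₂ =>
      refine ⟨fun x₁ hx₁ => ?_, fun x₂ hx₂ => ?_⟩
      · obtain ⟨g, hg, hb⟩ := ih₁.1 x₁ hx₁
        obtain ⟨g', hg', hd⟩ := ih₂.1 (fun j => g *ᵥ x₁ j) hb
        refine ⟨g' * g, isUnitaryOf_mul X.c X.H hg' hg, ?_⟩
        rw [hd]
        funext j
        simp [Matrix.mulVec_mulVec]
      · obtain ⟨g', hg', hb⟩ := ih₂.2 x₂ hx₂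
        obtain ⟨g, hg, ha⟩ := ih₁.2 (fun j => g' *ᵥ x₂ j) hb
        refine ⟨g * g', isUnitaryOf_mul X.c X.H hg hg', ?_⟩
        rw [ha]
        funext j
        simp [Matrix.mulVec_mulVec]
  exact (key _ _ hgen).1 x rfl

/-- **EVERY MAIN CLASS HAS A UNITARY REPRESENTATIVE `g • xm`** (the positive branch of the skeleton's `gRep`). -/
theorem exists_gRep (K : X.Level) (xm : X.Tuple) (c : X.MainClass K xm) :
    ∃ g : Matrix (Fin 3) (Fin 3) X.E, IsUnitaryOf X.c X.H g ∧
      X.classOf K (X.lines (fun j => g *ᵥ xm j)) = c.1 := by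
  obtain ⟨g, hg, hw⟩ := X.exists_unitary_of_orbitOf_eq xm c.2.symm
  exact ⟨g, hg, by rw [← hw]; exact Quot.out_eq c.1⟩

/-- `gRep` is unitary. -/
theorem gRep_isUnitaryOf (K : X.Level) (xm : X.Tuple) (c : X.MainClass K xm) :
    IsUnitaryOf X.c X.H (X.gRep K xm c) := by
  unfold T4Data.gRep
  rw [dif_pos (X.exists_gRep K xm c)]
  exact (Classical.choose_spec (X.exists_gRep K xm c)).1

/-- The representative tuple `mainRep K xm c = gRep • xm` lies in the class `c`. -/
theorem classOf_lines_mainRep (K : X.Level) (xm : X.Tuple) (c : X.MainClass K xm) :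
    X.classOf K (X.lines (X.mainRep K xm c)) = c.1 := by
  unfold T4Data.mainRep T4Data.gRep
  rw [dif_pos (X.exists_gRep K xm c)]
  exact (Classical.choose_spec (X.exists_gRep K xm c)).2

end T4Data

end Summit.Ventures.HodgeRepro.Tier4.Line3

end
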